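import Summits.PneNP.PneNP.Theses.Autoreducibility

/-!
# Route Autoreducibility — `TallyOfFull` (stmt-PneNP-15949)

`TallyOfFull := ThreeTTCompleteAutoreducible → TallyAutoreducible`: a full nonadaptive autoreduction (`A = ttLang Q q D A` with
`Q` never querying its own input) is in particular correct on the tally inputs `0ⁿ`. Elementary glue; imports only the route file.
-/

set_option linter.dupNamespace false -- `Summit.PneNP.PneNP.…`: summit = sub-problem name (D-0017 single-conjunct layout)

namespace Summit.PneNP.PneNP.Theorems

/-- **Support item `TallyOfFull` of route Autoreducibility (stmt-PneNP-15949)**: `ThreeTTCompleteAutoreducible → TallyAutoreducible`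
— restrict the full autoreduction identity `A = ttLang Q q D A` to tally inputs. [cite: BuhrmanEtAl2000] [folklore] -/
theorem autoreducibility_tallyOfFull_proof : Summit.PneNP.PneNP.Theses.Autoreducibility.TallyOfFull := by
  unfold Summit.PneNP.PneNP.Theses.Autoreducibility.TallyOfFull
    Summit.PneNP.PneNP.Theses.Autoreducibility.ThreeTTCompleteAutoreducible
    Summit.PneNP.PneNP.Theses.Autoreducibility.TallyAutoreducible
  intro hfull A hA hcomplete
  obtain ⟨Q, hQ, q, D, hD, hself, hEq⟩ := hfull A hA hcomplete
  exact ⟨Q, hQ, q, D, hD, hself, fun n => by rw [← hEq]⟩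

end Summit.PneNP.PneNP.Theorems
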